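import Literature.Analysis.FluidPDE.BoltzmannEquationProofs
import HarnessLib

/-!
# Antipodal symmetry of the surface measure of the unit sphere
(trunk T-KINETIC; topic Analysis/FluidPDE; generic lemmas on the accepted `Hilbert6.sphereMeasure`
of `Hilbert6Wave0`/`BoltzmannEquation`)

The accepted surface measure `Hilbert6.sphereMeasure = volume.toSphere` on the unit sphere of a
finite-dimensional real inner product space is invariant under the antipodal map `ω ↦ -ω`
(`sphereMeasure_map_neg`), whence the change of variables `∫ f(-ω) dω = ∫ f(ω) dω`
(`integral_comp_neg_sphere`) and the identity `∫ (u·ω)₊ dω = ∫ (u·ω)₋ dω`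
(`integral_posPart_inner_sphere_eq`) used to pass between the two sign conventions
`((v - v₁)·ν)₊` (BGSR (1.3), `Hilbert6.hardSphereKernel`) and `(ω·(v_{s+1} - v_i))_±`
(GST 2013 (4.3.6), `Kinetic.hsCollisionTerm`) of the hard-sphere cross-section, and to show
that gain and loss terms of background particles cancel in the tagged Boltzmann hierarchy
(BGSR Remark 3.4). Proof: `volume` is negation invariant (an additive Haar measure on an
abelian group, Mathlib's `IsAddHaarMeasure.isNegInvariant_of_regular`), and
`Measure.toSphere_apply'` expresses `volume.toSphere s` through `volume (Ioo 0 1 • s)`, a set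
whose preimage under negation is `Ioo 0 1 • (-s)`.

## References

* T. Bodineau, I. Gallagher, L. Saint-Raymond, Invent. Math. 203 (2016), (1.3), Remark 3.4.
* I. Gallagher, L. Saint-Raymond, B. Texier, *From Newton to Boltzmann* (2013), (4.3.6).
-/

open MeasureTheory Metric Real Set
open scoped InnerProductSpace Pointwise

namespace Literature.Analysis.FluidPDE

noncomputable section

variable {E : Type*} [NormedAddCommGroup E] [InnerProductSpace ℝ E] [FiniteDimensional ℝ E]
  [MeasurableSpace E] [BorelSpace E]

/-- **The surface measure of the unit sphere is invariant under the antipodal map** `ω ↦ -ω`.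
[folklore] -/
theorem sphereMeasure_map_neg :
    (Literature.MathematicalPhysics.KineticTheory.sphereMeasure : Measure (sphere (0 : E) 1)).map (fun ω => -ω) = Literature.MathematicalPhysics.KineticTheory.sphereMeasure := by
  refine Measure.ext fun s hs => ?_
  rw [Measure.map_apply measurable_neg hs, Literature.MathematicalPhysics.KineticTheory.sphereMeasure,
    Measure.toSphere_apply' _ (measurable_neg hs), Measure.toSphere_apply' _ hs]
  congr 1
  have hset : (Ioo (0 : ℝ) 1 • (((↑) : sphere (0 : E) 1 → E) '' ((fun ω => -ω) ⁻¹' s))) =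
      Neg.neg ⁻¹' (Ioo (0 : ℝ) 1 • (((↑) : sphere (0 : E) 1 → E) '' s)) := by
    ext x
    simp only [Set.mem_smul, Set.mem_image, Set.mem_preimage]
    constructor
    · rintro ⟨r, hr, y, ⟨ω, hω, rfl⟩, rfl⟩
      exact ⟨r, hr, ((-ω : sphere (0 : E) 1) : E), ⟨-ω, hω, rfl⟩, by simp [smul_neg]⟩
    · rintro ⟨r, hr, y, ⟨ω, hω, rfl⟩, h⟩
      refine ⟨r, hr, ((-ω : sphere (0 : E) 1) : E), ⟨-ω, by simpa using hω, rfl⟩, ?_⟩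
      have : r • (ω : E) = -x := h
      simp [smul_neg, this]
  rw [hset, Measure.measure_preimage_neg]

/-- The antipodal map preserves the surface measure. [folklore] -/
theorem measurePreserving_neg_sphere :
    MeasurePreserving (fun ω : sphere (0 : E) 1 => -ω) Literature.MathematicalPhysics.KineticTheory.sphereMeasure Literature.MathematicalPhysics.KineticTheory.sphereMeasure :=
  ⟨measurable_neg, sphereMeasure_map_neg⟩

/-- **Change of variables `ω ↦ -ω` in sphere integrals**: `∫ f(-ω) dω = ∫ f(ω) dω`. [folklore] -/
theorem integral_comp_neg_sphere {F : Type*} [NormedAddCommGroup F] [NormedSpace ℝ F]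
    (f : sphere (0 : E) 1 → F) :
    ∫ ω, f (-ω) ∂Literature.MathematicalPhysics.KineticTheory.sphereMeasure = ∫ ω, f ω ∂Literature.MathematicalPhysics.KineticTheory.sphereMeasure :=
  measurePreserving_neg_sphere.integral_comp (Homeomorph.neg (sphere (0 : E) 1)).measurableEmbedding f

/-- **`∫ (u·ω)₊ dω = ∫ (u·ω)₋ dω`**: the positive and negative parts of a linear form have the
same sphere integral (so the hard-sphere loss frequency may be written with either sign
convention). [folklore] -/
theorem integral_posPart_inner_sphere_eq (u : E) :
    ∫ ω : sphere (0 : E) 1, max ⟪u, (ω : E)⟫_ℝ 0 ∂Literature.MathematicalPhysics.KineticTheory.sphereMeasure =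
      ∫ ω : sphere (0 : E) 1, max (-⟪u, (ω : E)⟫_ℝ) 0 ∂Literature.MathematicalPhysics.KineticTheory.sphereMeasure := by
  rw [← integral_comp_neg_sphere (fun ω : sphere (0 : E) 1 => max ⟪u, (ω : E)⟫_ℝ 0)]
  simp [inner_neg_right]

/-- Weighted form: `∫ (u·ω)₊ g(ω) dω = ∫ (u·ω)₋ g(-ω) dω` for any `g`. [folklore] -/
theorem integral_posPart_inner_mul_sphere_eq (u : E) (g : sphere (0 : E) 1 → ℝ) :
    ∫ ω : sphere (0 : E) 1, max ⟪u, (ω : E)⟫_ℝ 0 * g ω ∂Literature.MathematicalPhysics.KineticTheory.sphereMeasure =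
      ∫ ω : sphere (0 : E) 1, max (-⟪u, (ω : E)⟫_ℝ) 0 * g (-ω) ∂Literature.MathematicalPhysics.KineticTheory.sphereMeasure := by
  rw [← integral_comp_neg_sphere (fun ω : sphere (0 : E) 1 => max ⟪u, (ω : E)⟫_ℝ 0 * g ω)]
  simp [inner_neg_right]

end

end Literature.Analysis.FluidPDE
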